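import Summits.BirchSwinnertonDyer.BirchSwinnertonDyer.Theorems.ManinLocalTwoThreeEulerRemaindersOneHundredEight
import Summits.BirchSwinnertonDyer.BirchSwinnertonDyer.Theorems.ManinLocalTwoThreeEulerRemaindersFiftySix
import Summits.BirchSwinnertonDyer.BirchSwinnertonDyer.Theorems.ManinLocalTwoThreeEulerTruncationsFortyFour
import Summits.BirchSwinnertonDyer.BirchSwinnertonDyer.Theorems.ManinLocalTwoThreeEisensteinPhiFortyFour
import HarnessLib

/-!
# Level 96, the `q`-toolkit: `E₂, E₄, E₆, E₈, E₁₂, E₁₆, E₂₄, E₃₂` and `E₂(δτ)` to `o(q³³)`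

Cell bsd-f2-manin, route `ManinLocalTwoThree` (crux C2 `ManinOddAtFour` stmt-22967: `2² ∣ 96`; `96 = 2⁵·3` is the first
treated level with `v₂(N) = 5` — the charter's "no semistable partner" cell; genus `9`, two newforms `96a`, `96b`), prover seat p3 gen 24.
Class `96a` (`96a1 = [0, 1, 0, -2, 0] : y² = x³ + x² − 2x`, full rational `2`-torsion): `𝓧 = x` is the single `η`-quotient
`etaQuotient 96 (expFn [(2, 1), (4, -1), (6, -3), (8, -1), (12, 3), (16, 1), (24, 3), (48, -3)])` (`Γ₀(96)`-invariant), `𝓨 = η(expFn [(2, 1), (6, -3), (12, 2), (16, 1), (24, 2), (48, -3)])` satisfies `x′ = −2πiφ·2𝓨`, `𝓨² = x³ + x² − 2x`, and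
`φ₉₆a = B2 + B3 + B4 + 2B5` on an-g51's `η`-basis `B₁…B₅` of the new part (cell HOME/an/g51 `newform-coords-D.out`; the PINNING `⇑D.f = φ₉₆a` is
NOT proved here).  THE E₂ ROAD (`EtaLogDerivativeForms`): `𝓧′ = (πi/12)G_𝓧𝓧`, `𝓨′ = (πi/12)G_𝓨𝓨`; `A_j = B_jη(r_𝓨)/𝓧`,
`C_j^{(2)} = B_j𝓧²/η(r_𝓨)`, `C_j^{(1)} = B_j𝓧/η(r_𝓨)`, `C_j^{(0)} = B_j/η(r_𝓨)` are INDIVIDUALLY HOLOMORPHIC weight-`2` `η`-quotients on `Γ₀(96)`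
(Ligozat orders, `decide`), so (I2a), (I2b) are LINEAR relations in `M₂(Γ₀(96))` settled by Sturm (`μ = 192`, `⌊2·192/12⌋ + 1 = 33`
coefficients).
This file: the `q`-expansions to `o(q³³)` (pentagonal coefficients from the tree's `coeff_formalEulerPow_one_le_sixteen`; `E₂`, `E₄`, `E₂(2τ)`,
`E₂(4τ)` to the same depth are p1's `LevelFortyFour.*_thirtyThree`, reused).
Pure `q`-series bookkeeping. Nothing here proves C2, Manin's conjecture or BSD; the class-`96b` half and the newform PINNING at `96` are separate; item 22967 stays OPEN. [cite: Zagier2008, §2.3] [cite: Ligozat1975, Ch. 3]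
-/

set_option autoImplicit false
-- lint-debt: the directory name repeats the summit name (sibling precedent `ManinLocalTwoThreeEulerRemaindersSeventyTwo.lean`)
set_option linter.dupNamespace false

noncomputable section

open Complex Filter Topology Set Asymptotics Polynomial EisensteinSeries
open UpperHalfPlane hiding I
open scoped Real Topology Manifold MatrixGroups ModularForm
open ModularForm CongruenceSubgroup
open Literature.NumberTheory.ModularForms
open Literature.NumberTheory.EllipticCurves Literature.NumberTheory.EllipticCurves.ModularForms

namespace Summit.BirchSwinnertonDyer.BirchSwinnertonDyer.Theorems.ManinLocalTwoThree.EulerRemaindersNinetySix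

open QRemainder EulerRemainders EtaLogDerivativeForms LevelFortyFour

/-- The `q`-coefficients `n ≤ 33` of `E6`. [folklore] -/
theorem coeff_formalEulerScaled_six_le (n : ℕ) (hn : n ≤ 33) :
    PowerSeries.coeff n (formalEulerScaled 6) = if n = 0 then 1 else if n = 6 then -1 else if n = 12 then -1 else if n = 30 then 1 else 0 := by
  have h := EulerRemaindersTwenty.coeff_formalEulerPow_one_le_six
  interval_cases n <;> simp +decide [coeff_formalEulerScaled, h]

/-- **`E6` to `o(q³³)`.** [folklore] -/
theorem tendsto_eulerFn_six :
    Tendsto (fun τ : ℍ ↦ (eulerFn 6 τ - (1 - X ^ 6 - X ^ 12 + X ^ 30 : ℂ[X]).eval (Function.Periodic.qParam 1 (τ : ℂ))) / Function.Periodic.qParam 1 (τ : ℂ) ^ 33) atImInfty (𝓝 0) := by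
  refine congr_poly ?_ (tendsto_of_hasSum (periodic_eulerFn 6) (mdifferentiable_eulerFn 6)
    (isBoundedAtImInfty_eulerFn (by norm_num)) (hasSum_eulerFn (by norm_num)) 33)
  have h := coeff_formalEulerScaled_six_le
  simp only [Finset.sum_range_succ, Finset.sum_range_zero, h 0 (by norm_num), h 1 (by norm_num), h 2 (by norm_num), h 3 (by norm_num), h 4 (by norm_num), h 5 (by norm_num), h 6 (by norm_num), h 7 (by norm_num), h 8 (by norm_num), h 9 (by norm_num), h 10 (by norm_num), h 11 (by norm_num), h 12 (by norm_num), h 13 (by norm_num), h 14 (by norm_num), h 15 (by norm_num), h 16 (by norm_num), h 17 (by norm_num), h 18 (by norm_num), h 19 (by norm_num), h 20 (by norm_num), h 21 (by norm_num), h 22 (by norm_num), h 23 (by norm_num), h 24 (by norm_num), h 25 (by norm_num), h 26 (by norm_num), h 27 (by norm_num), h 28 (by norm_num), h 29 (by norm_num), h 30 (by norm_num), h 31 (by norm_num), h 32 (by norm_num), h 33 (by norm_num)]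
  norm_num
  ring

/-- The `q`-coefficients `n ≤ 33` of `E8`. [folklore] -/
theorem coeff_formalEulerScaled_eight_le (n : ℕ) (hn : n ≤ 33) :
    PowerSeries.coeff n (formalEulerScaled 8) = if n = 0 then 1 else if n = 8 then -1 else if n = 16 then -1 else 0 := by
  have h := EulerRemaindersTwenty.coeff_formalEulerPow_one_le_six
  interval_cases n <;> simp +decide [coeff_formalEulerScaled, h]

/-- **`E8` to `o(q³³)`.** [folklore] -/
theorem tendsto_eulerFn_eight :
    Tendsto (fun τ : ℍ ↦ (eulerFn 8 τ - (1 - X ^ 8 - X ^ 16 : ℂ[X]).eval (Function.Periodic.qParam 1 (τ : ℂ))) / Function.Periodic.qParam 1 (τ : ℂ) ^ 33) atImInfty (𝓝 0) := by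
  refine congr_poly ?_ (tendsto_of_hasSum (periodic_eulerFn 8) (mdifferentiable_eulerFn 8)
    (isBoundedAtImInfty_eulerFn (by norm_num)) (hasSum_eulerFn (by norm_num)) 33)
  have h := coeff_formalEulerScaled_eight_le
  simp only [Finset.sum_range_succ, Finset.sum_range_zero, h 0 (by norm_num), h 1 (by norm_num), h 2 (by norm_num), h 3 (by norm_num), h 4 (by norm_num), h 5 (by norm_num), h 6 (by norm_num), h 7 (by norm_num), h 8 (by norm_num), h 9 (by norm_num), h 10 (by norm_num), h 11 (by norm_num), h 12 (by norm_num), h 13 (by norm_num), h 14 (by norm_num), h 15 (by norm_num), h 16 (by norm_num), h 17 (by norm_num), h 18 (by norm_num), h 19 (by norm_num), h 20 (by norm_num), h 21 (by norm_num), h 22 (by norm_num), h 23 (by norm_num), h 24 (by norm_num), h 25 (by norm_num), h 26 (by norm_num), h 27 (by norm_num), h 28 (by norm_num), h 29 (by norm_num), h 30 (by norm_num), h 31 (by norm_num), h 32 (by norm_num), h 33 (by norm_num)]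
  norm_num
  ring

/-- The `q`-coefficients `n ≤ 33` of `E12`. [folklore] -/
theorem coeff_formalEulerScaled_twelve_le (n : ℕ) (hn : n ≤ 33) :
    PowerSeries.coeff n (formalEulerScaled 12) = if n = 0 then 1 else if n = 12 then -1 else if n = 24 then -1 else 0 := by
  have h := EulerRemaindersTwenty.coeff_formalEulerPow_one_le_six
  interval_cases n <;> simp +decide [coeff_formalEulerScaled, h]

/-- **`E12` to `o(q³³)`.** [folklore] -/
theorem tendsto_eulerFn_twelve :
    Tendsto (fun τ : ℍ ↦ (eulerFn 12 τ - (1 - X ^ 12 - X ^ 24 : ℂ[X]).eval (Function.Periodic.qParam 1 (τ : ℂ))) / Function.Periodic.qParam 1 (τ : ℂ) ^ 33) atImInfty (𝓝 0) := by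
  refine congr_poly ?_ (tendsto_of_hasSum (periodic_eulerFn 12) (mdifferentiable_eulerFn 12)
    (isBoundedAtImInfty_eulerFn (by norm_num)) (hasSum_eulerFn (by norm_num)) 33)
  have h := coeff_formalEulerScaled_twelve_le
  simp only [Finset.sum_range_succ, Finset.sum_range_zero, h 0 (by norm_num), h 1 (by norm_num), h 2 (by norm_num), h 3 (by norm_num), h 4 (by norm_num), h 5 (by norm_num), h 6 (by norm_num), h 7 (by norm_num), h 8 (by norm_num), h 9 (by norm_num), h 10 (by norm_num), h 11 (by norm_num), h 12 (by norm_num), h 13 (by norm_num), h 14 (by norm_num), h 15 (by norm_num), h 16 (by norm_num), h 17 (by norm_num), h 18 (by norm_num), h 19 (by norm_num), h 20 (by norm_num), h 21 (by norm_num), h 22 (by norm_num), h 23 (by norm_num), h 24 (by norm_num), h 25 (by norm_num), h 26 (by norm_num), h 27 (by norm_num), h 28 (by norm_num), h 29 (by norm_num), h 30 (by norm_num), h 31 (by norm_num), h 32 (by norm_num), h 33 (by norm_num)]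
  norm_num
  ring

/-- The `q`-coefficients `n ≤ 33` of `E16`. [folklore] -/
theorem coeff_formalEulerScaled_sixteen_le (n : ℕ) (hn : n ≤ 33) :
    PowerSeries.coeff n (formalEulerScaled 16) = if n = 0 then 1 else if n = 16 then -1 else if n = 32 then -1 else 0 := by
  have h := EulerRemaindersTwenty.coeff_formalEulerPow_one_le_six
  interval_cases n <;> simp +decide [coeff_formalEulerScaled, h]

/-- **`E16` to `o(q³³)`.** [folklore] -/
theorem tendsto_eulerFn_sixteen :
    Tendsto (fun τ : ℍ ↦ (eulerFn 16 τ - (1 - X ^ 16 - X ^ 32 : ℂ[X]).eval (Function.Periodic.qParam 1 (τ : ℂ))) / Function.Periodic.qParam 1 (τ : ℂ) ^ 33) atImInfty (𝓝 0) := by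
  refine congr_poly ?_ (tendsto_of_hasSum (periodic_eulerFn 16) (mdifferentiable_eulerFn 16)
    (isBoundedAtImInfty_eulerFn (by norm_num)) (hasSum_eulerFn (by norm_num)) 33)
  have h := coeff_formalEulerScaled_sixteen_le
  simp only [Finset.sum_range_succ, Finset.sum_range_zero, h 0 (by norm_num), h 1 (by norm_num), h 2 (by norm_num), h 3 (by norm_num), h 4 (by norm_num), h 5 (by norm_num), h 6 (by norm_num), h 7 (by norm_num), h 8 (by norm_num), h 9 (by norm_num), h 10 (by norm_num), h 11 (by norm_num), h 12 (by norm_num), h 13 (by norm_num), h 14 (by norm_num), h 15 (by norm_num), h 16 (by norm_num), h 17 (by norm_num), h 18 (by norm_num), h 19 (by norm_num), h 20 (by norm_num), h 21 (by norm_num), h 22 (by norm_num), h 23 (by norm_num), h 24 (by norm_num), h 25 (by norm_num), h 26 (by norm_num), h 27 (by norm_num), h 28 (by norm_num), h 29 (by norm_num), h 30 (by norm_num), h 31 (by norm_num), h 32 (by norm_num), h 33 (by norm_num)]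
  norm_num
  ring

/-- The `q`-coefficients `n ≤ 33` of `E24`. [folklore] -/
theorem coeff_formalEulerScaled_twentyFour_le (n : ℕ) (hn : n ≤ 33) :
    PowerSeries.coeff n (formalEulerScaled 24) = if n = 0 then 1 else if n = 24 then -1 else 0 := by
  have h := EulerRemaindersTwenty.coeff_formalEulerPow_one_le_six
  interval_cases n <;> simp +decide [coeff_formalEulerScaled, h]

/-- **`E24` to `o(q³³)`.** [folklore] -/
theorem tendsto_eulerFn_twentyFour :
    Tendsto (fun τ : ℍ ↦ (eulerFn 24 τ - (1 - X ^ 24 : ℂ[X]).eval (Function.Periodic.qParam 1 (τ : ℂ))) / Function.Periodic.qParam 1 (τ : ℂ) ^ 33) atImInfty (𝓝 0) := by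
  refine congr_poly ?_ (tendsto_of_hasSum (periodic_eulerFn 24) (mdifferentiable_eulerFn 24)
    (isBoundedAtImInfty_eulerFn (by norm_num)) (hasSum_eulerFn (by norm_num)) 33)
  have h := coeff_formalEulerScaled_twentyFour_le
  simp only [Finset.sum_range_succ, Finset.sum_range_zero, h 0 (by norm_num), h 1 (by norm_num), h 2 (by norm_num), h 3 (by norm_num), h 4 (by norm_num), h 5 (by norm_num), h 6 (by norm_num), h 7 (by norm_num), h 8 (by norm_num), h 9 (by norm_num), h 10 (by norm_num), h 11 (by norm_num), h 12 (by norm_num), h 13 (by norm_num), h 14 (by norm_num), h 15 (by norm_num), h 16 (by norm_num), h 17 (by norm_num), h 18 (by norm_num), h 19 (by norm_num), h 20 (by norm_num), h 21 (by norm_num), h 22 (by norm_num), h 23 (by norm_num), h 24 (by norm_num), h 25 (by norm_num), h 26 (by norm_num), h 27 (by norm_num), h 28 (by norm_num), h 29 (by norm_num), h 30 (by norm_num), h 31 (by norm_num), h 32 (by norm_num), h 33 (by norm_num)]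
  norm_num
  ring

/-- The `q`-coefficients `n ≤ 33` of `E32`. [folklore] -/
theorem coeff_formalEulerScaled_thirtyTwo_le (n : ℕ) (hn : n ≤ 33) :
    PowerSeries.coeff n (formalEulerScaled 32) = if n = 0 then 1 else if n = 32 then -1 else 0 := by
  have h := EulerRemaindersTwenty.coeff_formalEulerPow_one_le_six
  interval_cases n <;> simp +decide [coeff_formalEulerScaled, h]

/-- **`E32` to `o(q³³)`.** [folklore] -/
theorem tendsto_eulerFn_thirtyTwo :
    Tendsto (fun τ : ℍ ↦ (eulerFn 32 τ - (1 - X ^ 32 : ℂ[X]).eval (Function.Periodic.qParam 1 (τ : ℂ))) / Function.Periodic.qParam 1 (τ : ℂ) ^ 33) atImInfty (𝓝 0) := by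
  refine congr_poly ?_ (tendsto_of_hasSum (periodic_eulerFn 32) (mdifferentiable_eulerFn 32)
    (isBoundedAtImInfty_eulerFn (by norm_num)) (hasSum_eulerFn (by norm_num)) 33)
  have h := coeff_formalEulerScaled_thirtyTwo_le
  simp only [Finset.sum_range_succ, Finset.sum_range_zero, h 0 (by norm_num), h 1 (by norm_num), h 2 (by norm_num), h 3 (by norm_num), h 4 (by norm_num), h 5 (by norm_num), h 6 (by norm_num), h 7 (by norm_num), h 8 (by norm_num), h 9 (by norm_num), h 10 (by norm_num), h 11 (by norm_num), h 12 (by norm_num), h 13 (by norm_num), h 14 (by norm_num), h 15 (by norm_num), h 16 (by norm_num), h 17 (by norm_num), h 18 (by norm_num), h 19 (by norm_num), h 20 (by norm_num), h 21 (by norm_num), h 22 (by norm_num), h 23 (by norm_num), h 24 (by norm_num), h 25 (by norm_num), h 26 (by norm_num), h 27 (by norm_num), h 28 (by norm_num), h 29 (by norm_num), h 30 (by norm_num), h 31 (by norm_num), h 32 (by norm_num), h 33 (by norm_num)]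
  norm_num
  ring

/-- **`E₂(6τ)` to `o(q³³)`.** [cite: Zagier2008, §2.3] -/
theorem tendsto_E2_six :
    Tendsto (fun τ : ℍ ↦ (E2 (sixMulPt 6 τ) - (1 - 24 * X ^ 6 - 72 * X ^ 12 - 96 * X ^ 18 - 168 * X ^ 24 - 144 * X ^ 30 : ℂ[X]).eval (Function.Periodic.qParam 1 (τ : ℂ))) / Function.Periodic.qParam 1 (τ : ℂ) ^ 33) atImInfty (𝓝 0) := by
  refine congr_poly ?_ (tendsto_E2_sixMulPt (by norm_num : 0 < 6) 33)
  obtain ⟨s1, s2, s3, s4, s5, s6, s7, s8, s9, s10, s11, s12, s13, s14, s15, s16, s17, s18, s19, s20, s21, s22, s23, s24, s25, s26, s27, s28, s29, s30, s31, s32, s33⟩ := LevelFortyFour.sigma_one_le_thirtyThree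
  simp only [Finset.sum_range_succ, Finset.sum_range_zero, e2NatMulCoeff_eq _ _ (by norm_num : 0 < 6)]
  norm_num [s1, s2, s3, s4, s5, s6, s7, s8, s9, s10, s11, s12, s13, s14, s15, s16]
  simp only [map_ofNat]
  ring

/-- **`E₂(8τ)` to `o(q³³)`.** [cite: Zagier2008, §2.3] -/
theorem tendsto_E2_eight :
    Tendsto (fun τ : ℍ ↦ (E2 (sixMulPt 8 τ) - (1 - 24 * X ^ 8 - 72 * X ^ 16 - 96 * X ^ 24 - 168 * X ^ 32 : ℂ[X]).eval (Function.Periodic.qParam 1 (τ : ℂ))) / Function.Periodic.qParam 1 (τ : ℂ) ^ 33) atImInfty (𝓝 0) := by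
  refine congr_poly ?_ (tendsto_E2_sixMulPt (by norm_num : 0 < 8) 33)
  obtain ⟨s1, s2, s3, s4, s5, s6, s7, s8, s9, s10, s11, s12, s13, s14, s15, s16, s17, s18, s19, s20, s21, s22, s23, s24, s25, s26, s27, s28, s29, s30, s31, s32, s33⟩ := LevelFortyFour.sigma_one_le_thirtyThree
  simp only [Finset.sum_range_succ, Finset.sum_range_zero, e2NatMulCoeff_eq _ _ (by norm_num : 0 < 8)]
  norm_num [s1, s2, s3, s4, s5, s6, s7, s8, s9, s10, s11, s12, s13, s14, s15, s16]
  simp only [map_ofNat]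
  ring

/-- **`E₂(12τ)` to `o(q³³)`.** [cite: Zagier2008, §2.3] -/
theorem tendsto_E2_twelve :
    Tendsto (fun τ : ℍ ↦ (E2 (sixMulPt 12 τ) - (1 - 24 * X ^ 12 - 72 * X ^ 24 : ℂ[X]).eval (Function.Periodic.qParam 1 (τ : ℂ))) / Function.Periodic.qParam 1 (τ : ℂ) ^ 33) atImInfty (𝓝 0) := by
  refine congr_poly ?_ (tendsto_E2_sixMulPt (by norm_num : 0 < 12) 33)
  obtain ⟨s1, s2, s3, s4, s5, s6, s7, s8, s9, s10, s11, s12, s13, s14, s15, s16, s17, s18, s19, s20, s21, s22, s23, s24, s25, s26, s27, s28, s29, s30, s31, s32, s33⟩ := LevelFortyFour.sigma_one_le_thirtyThree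
  simp only [Finset.sum_range_succ, Finset.sum_range_zero, e2NatMulCoeff_eq _ _ (by norm_num : 0 < 12)]
  norm_num [s1, s2, s3, s4, s5, s6, s7, s8, s9, s10, s11, s12, s13, s14, s15, s16]
  simp only [map_ofNat]
  ring

/-- **`E₂(16τ)` to `o(q³³)`.** [cite: Zagier2008, §2.3] -/
theorem tendsto_E2_sixteen :
    Tendsto (fun τ : ℍ ↦ (E2 (sixMulPt 16 τ) - (1 - 24 * X ^ 16 - 72 * X ^ 32 : ℂ[X]).eval (Function.Periodic.qParam 1 (τ : ℂ))) / Function.Periodic.qParam 1 (τ : ℂ) ^ 33) atImInfty (𝓝 0) := by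
  refine congr_poly ?_ (tendsto_E2_sixMulPt (by norm_num : 0 < 16) 33)
  obtain ⟨s1, s2, s3, s4, s5, s6, s7, s8, s9, s10, s11, s12, s13, s14, s15, s16, s17, s18, s19, s20, s21, s22, s23, s24, s25, s26, s27, s28, s29, s30, s31, s32, s33⟩ := LevelFortyFour.sigma_one_le_thirtyThree
  simp only [Finset.sum_range_succ, Finset.sum_range_zero, e2NatMulCoeff_eq _ _ (by norm_num : 0 < 16)]
  norm_num [s1, s2, s3, s4, s5, s6, s7, s8, s9, s10, s11, s12, s13, s14, s15, s16]
  simp only [map_ofNat]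
  ring

/-- **`E₂(24τ)` to `o(q³³)`.** [cite: Zagier2008, §2.3] -/
theorem tendsto_E2_twentyFour :
    Tendsto (fun τ : ℍ ↦ (E2 (sixMulPt 24 τ) - (1 - 24 * X ^ 24 : ℂ[X]).eval (Function.Periodic.qParam 1 (τ : ℂ))) / Function.Periodic.qParam 1 (τ : ℂ) ^ 33) atImInfty (𝓝 0) := by
  refine congr_poly ?_ (tendsto_E2_sixMulPt (by norm_num : 0 < 24) 33)
  obtain ⟨s1, s2, s3, s4, s5, s6, s7, s8, s9, s10, s11, s12, s13, s14, s15, s16, s17, s18, s19, s20, s21, s22, s23, s24, s25, s26, s27, s28, s29, s30, s31, s32, s33⟩ := LevelFortyFour.sigma_one_le_thirtyThree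
  simp only [Finset.sum_range_succ, Finset.sum_range_zero, e2NatMulCoeff_eq _ _ (by norm_num : 0 < 24)]
  norm_num [s1, s2, s3, s4, s5, s6, s7, s8, s9, s10, s11, s12, s13, s14, s15, s16]
  simp only [map_ofNat]
  ring

/-- **`E₂(48τ) = 1 + o(q³³)`.** [cite: Zagier2008, §2.3] -/
theorem tendsto_E2_fortyEight :
    Tendsto (fun τ : ℍ ↦ (E2 (sixMulPt 48 τ) - (1 : ℂ[X]).eval (Function.Periodic.qParam 1 (τ : ℂ))) / Function.Periodic.qParam 1 (τ : ℂ) ^ 33) atImInfty (𝓝 0) := by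
  refine congr_poly ?_ (tendsto_E2_sixMulPt (by norm_num : 0 < 48) 33)
  simp only [Finset.sum_range_succ, Finset.sum_range_zero, e2NatMulCoeff_eq _ _ (by norm_num : 0 < 48)]
  norm_num

end Summit.BirchSwinnertonDyer.BirchSwinnertonDyer.Theorems.ManinLocalTwoThree.EulerRemaindersNinetySix

end
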